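import Summits.BirchSwinnertonDyer.Rank1Residual.X11a.ClassClosureRamTwist
import HarnessLib

/-!
# Class X11a, PRINT tier, seat p1: the ONE-factor Eisenstein half of Mazur's main conjecture at a
# multiplicative prime — the output shape of Skinner 2016 §3.1 — typed, and shown EQUIVALENT on
# the surjective leaf to the full main conjecture (Kato–Wuthrich supplies the other half)

Cell `bsd-print-x11a` (run/shared/lean/pub/bsd-print-x11a/), prover seat p1, strategy «Skinner
2016 Thm C variants BY NAME with the ramified-prime hypothesis removed via BCS 2024 base change:
type + discharge»; companion of `X11a/PrintSkinnerThmCNoRam.lean` (the (ii)-deleted Theorem C =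
the leaf). HONEST FRAMING: nothing is asserted; no pair or class is closed; ONE typed OPEN input
(a `Prop`, never a fact) and theorems over the tree's own objects; every published input is an
explicit NAMED-FACT hypothesis already in the tree; no label changes.

WHAT. Skinner's proof of Thm. A at `p ‖ N` (Pacific J. Math. 283 (2016) §3.1, p. 192
[paper:arxiv-1407.1093 p0013 L12–L60]) is a ONE-SIDED-capable congruence argument: from the
Eisenstein-side inclusions `Ch_Λ(X(f_m)) ⊆ (𝓛_{f_m})` at the good-ordinary Hida members
`f_m ≡ f_E (mod p^m)` and the congruences of Selmer groups and `p`-adic `L`-functions it yields, by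
Krull's intersection theorem (tree: `X11b.CongruenceTransfer.le_span_singleton_of_forall_congruence`,
`X2.HidaLimitAlgebra.map_le_span_of_oneSided_congruences`), the Eisenstein-side inclusion AT `f_E`;
the opposite inclusion is Kato's. So what a (ram)-free run of §3.1 (fed by a weight-`k` BCS theorem,
NOT in print — see the companion file's "Beyond print: YES") would OUTPUT at the pair `(E, p)` is
exactly the ONE-factor display typed here:

  `EisensteinHalfAt W p`: for the cyclotomic data `(κ, γ)`, every newform `f` of `W`, every dual
  Selmer datum `D`, every `ϖ` with `ϖ · Ω_E = Ω⁺_f` and THE multiplicative Mazur–Tate–Teitelbaum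
  function `L`: some `G ∈ Λ` has `ι G = ϖ · L` and `(T^e) · ch X ⊆ (G)`

— the `n = 1` member of the family of integral displays already on the tree (`n = 4`: the
Burungale–Castella–Skinner display `X11a.BaseChangeLowerBoundAt`, gen 23; `n = 2`: the ram-twist
display `X11a.RamTwistLowerBoundAt`, cc-typer-3), in the same Néron normalisation with the trivial
zero carried by `trivialZeroFactor`. Theorems (all by name over tree objects):
* `isUnit_of_mul_mem_span₁` — the one-factor cancellation (`t c ∈ (t h c)`, `t c ≠ 0` ⇒ `h` unit);
* **`mazurMainConjectureAt_of_eisensteinHalf`**: `p ≥ 5` multiplicative, `ρ̄_{E,p}` onto: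
  `EisensteinHalfAt W p → X2.MazurMainConjectureAt W p` (Kato–Wuthrich A32 gives `k = h c ∈ ch X`
  with `ι(T^e k) = ϖ L`; injectivity of `ι` makes `G = T^e h c`; `T^e c ∈ (G)` forces `h ∈ Λ^×`);
* **`eisensteinHalfAt_of_mazurMainConjectureAt`**: the converse, unconditionally (pure algebra);
* **`eisensteinHalfAt_iff_mazurMainConjectureAt`**: on {`p ≥ 5`, `p ‖ N`, `ρ̄` onto} the one-sided
  input IS the cell's typed input of record — neither weaker nor stronger there;
* **`eisensteinHalfAt_of_thmA_of_ram`**: at a (ram) pair the display is PRINT (Skinner Thm. A,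
  named fact `thmA_charIdeal_multiplicative`) — so, like `ThmCNoRam`, it exceeds print exactly at
  `¬ Ram`;
* **`bsdp_of_eisensteinHalf`**: on X11a at `p ≥ 5` with `ρ̄_{E,p}` onto, `BSD(E,p)` ⇐ the display +
  A32 + Stein–Wuthrich 2013 Thm. 6.1 ×2 + Greenberg–Stevens + GZK + modularity (height-free chain);
  `missingLowerBoundAt_of_eisensteinHalf`: hence the body of the cell's residual crux of record
  `X11aLowerHalf` (item stmt-BirchSwinnertonDyer-19064: `ClassX11a W p → Typed.MissingLowerBoundAt W p`)
  at every such pair — road p1 feeds 19064 BY NAME on the sub-leaf `5 ≤ p ∧ Surj`, nowhere else.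

WHY type the half separately (when on the surjective leaf it is equivalent to the whole): because
it is the CURRENCY in which road p1 delivers — a one-sided transfer from the members needs only
one-sided inputs upstairs (the Eisenstein divisibility at good ordinary level, weight `k_m > 2`,
no (mult): the NAMED residual crux of road p1), and lands one-sidedly; this file is the socket that
turns that landing into `BSD(E,p)` on `Leaf ∧ Surj` by name. Off the surjective leaf (irreducible
non-surjective `ρ̄`, `p ∈ {5, 7}`) Kato's half is itself not in print integrally (Wuthrich 2014
p. 399), and the equivalence is not claimed there.

References: [Skinner2016PacificMC] Thm. A, §3.1–3.3; [Wuthrich2014] Thm. 3, Cor. 19 (A32);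
[Kato2004Asterisque] Thm. 17.4; [BurungaleCastellaSkinner2025] (5.3)–(5.4) (the `n = 4` display);
tree: `X11a/BaseChangeRoute.lean`, `X11a/ClassClosureRamTwist.lean`, `X11a/ChainHeightFree.lean`.
-/

set_option autoImplicit false

noncomputable section

open scoped Classical MatrixGroups ModularForm

open CongruenceSubgroup WeierstrassCurve Literature.NumberTheory.EllipticCurves
  Literature.NumberTheory.EllipticCurves.ModularForms
  Literature.NumberTheory.EllipticCurves.Rank1Residual
  Literature.NumberTheory.EllipticCurves.Rank1Residual.Typed
  Literature.NumberTheory.EllipticCurves.Wuthrich2014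
  Literature.NumberTheory.EllipticCurves.SteinWuthrich2013
  Literature.NumberTheory.EllipticCurves.Skinner2016

namespace Summit.BirchSwinnertonDyer.Rank1Residual.X11a

section Typed

variable (W : WeierstrassCurve ℚ) [W.IsElliptic] [W.IsGloballyMinimal] (p : ℕ) [Fact p.Prime]

/-- **Typed OPEN input (nothing asserted; never a fact): the Eisenstein half of Mazur's main
conjecture at the multiplicative prime `p` for `E`, Néron-normalised, with the trivial zero** — for
the cyclotomic data `(κ, γ)`, every newform `f` of the globally minimal `W`, every Pontryagin-dual
datum `D` of `Sel_{p^∞}(E/ℚ_∞)`, every `ϖ ∈ ℚ` with `ϖ · Ω_E = Ω⁺_f` and THE multiplicative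
Mazur–Tate–Teitelbaum function `L` (`IsTheMultPAdicLFunctionOf`): some `G ∈ Λ = ℤ_p⟦T⟧` has
`ι G = ϖ · L` and `(T^e) · ch_Λ X(E/ℚ_∞) ⊆ (G)` (`e = 1` split, `0` non-split), i.e. "`ϖ L_p` is
integral and DIVIDES `T^e · char X`" — the Skinner–Urban direction of `X2.MazurMainConjectureAt W p`
(whose other direction is Kato's). It is verbatim the Eisenstein-side half of the conclusion of
`Skinner2016.thmA_charIdeal_multiplicative` (printed under (iii) = (ram)), and the shape in which
Skinner 2016 §3.1's one-sided congruence transfer from the good-ordinary Hida members delivers at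
`f_E`. STATUS: PRINT at (ram) pairs (`eisensteinHalfAt_of_thmA_of_ram`); OPEN at `¬ Ram` (no
(ram)-free Eisenstein divisibility at `p ‖ N` or at the higher-weight members is in print:
companion file `PrintSkinnerThmCNoRam.lean`, "Beyond print"). One-factor member of the family
`BaseChangeLowerBoundAt` (4 factors) / `RamTwistLowerBoundAt` (2 factors).
[cite: Skinner2016PacificMC, Thm. A (§1) with §3.1–3.3 (shape only; Eisenstein half; nothing asserted)] -/
def EisensteinHalfAt : Prop :=
  ∀ (κ : ZpExtension ℚ p) (γ : Field.absoluteGaloisGroup ℚ),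
      κ.IsCyclotomic → κ.IsTopGenerator γ → IsCyclotomicVariable p γ →
    ∀ {N : ℕ} [NeZero N] (f : CuspForm (Gamma0 N) 2), IsNewformOf W f →
    ∀ (D : W.SelmerDualData κ γ) (ϖ : ℚ), (ϖ : ℝ) * W.realPeriodRat = plusPeriod f →
    ∀ (L : PowerSeries ℚ_[p]), IsTheMultPAdicLFunctionOf W f p L →
    ∃ G : IwasawaAlgebra p,
      iwasawaToPowerSeries p G = PowerSeries.C ((ϖ : ℚ) : ℚ_[p]) * L ∧
        Ideal.span {trivialZeroFactor W p} * D.charIdeal ≤ Ideal.span {G}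

end Typed

/-- **Pure algebra, one factor** (cf. `isUnit_of_prod_mem_span`, `isUnit_of_prod_mem_span₂`): in a
domain, `t ≠ 0`, `c ≠ 0` and `t · c ∈ (t · h · c)` force `h` to be a unit. [folklore] -/
theorem isUnit_of_mul_mem_span₁ {R : Type*} [CommRing R] [IsDomain R] {t c h : R}
    (ht : t ≠ 0) (hc : c ≠ 0) (hmem : t * c ∈ Ideal.span {t * (h * c)}) : IsUnit h := by
  obtain ⟨a, ha⟩ := Ideal.mem_span_singleton'.mp hmem
  have hne : t * c ≠ 0 := mul_ne_zero ht hc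
  have key : a * h * (t * c) = 1 * (t * c) := by linear_combination ha
  have h1 : a * h = 1 := mul_right_cancel₀ hne key
  exact IsUnit.of_mul_eq_one a (by rw [mul_comm]; exact h1)

section Main

variable (W : WeierstrassCurve ℚ) [W.IsElliptic] [W.IsGloballyMinimal] (p : ℕ) [Fact p.Prime]

/-- **The Eisenstein half + Kato–Wuthrich ⇒ Mazur's main conjecture at `(E, p)`**, for `p ≥ 5`
multiplicative with `ρ̄_{E,p}` onto, INTEGRALLY: A32 (`hKato`, PUBLISHED: Wuthrich 2014 Thm. 3 /
Cor. 19 ⇐ Kato Thm. 17.4; `ρ̄_{E,p^n}` onto for all `n` by Serre from `p ≥ 5`) gives `X` torsion and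
`k = h · c ∈ ch X = (c)` with `ι(T^e · k) = ϖ · L`; the typed input gives `G` with `ι G = ϖ · L`
and `T^e · c ∈ (G)`; `ι` is injective, so `G = T^e · h · c`, and cancelling `T^e · c ≠ 0` in the
domain `Λ` makes `h` a unit — Mazur's statement with `g = c`, `w = h`. The one-factor twin of
`mazurMainConjectureAt_of_baseChangeLowerBound` / `mazurMainConjectureAt_of_ramTwistLowerBound`.
[cite: Wuthrich2014, Thm. 3 (p. 383) and Cor. 19 (pp. 398–399)] [cite: Kato2004Asterisque, Thm. 17.4]
[cite: Skinner2016PacificMC, §3.2–3.3 (shape)] -/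
theorem mazurMainConjectureAt_of_eisensteinHalf
    (hKato : kato_charIdeal_dvd_multiplicative_of_surjective)
    (hp : 5 ≤ p) (hmult : W.HasMultiplicativeReductionAtPrime p) (hsurj : Surj W p)
    (hE : EisensteinHalfAt W p) : X2.MazurMainConjectureAt W p := by
  intro κ γ hκ hγ hγ' N _ f hf D ϖ hϖ
  have hp2 : p ≠ 2 := by omega
  have hs₀ : ∀ n : ℕ, W.HasSurjectiveModNGaloisRep (p ^ n : ℕ) :=
    kato_charIdeal_dvd_multiplicative_of_surjective.surjective_pow_of_five_le W p hp hsurj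
  obtain ⟨c₀, hc₀, hc₀0⟩ := exists_charIdeal_eq_span_singleton p D
  -- the core: for THE function `L` of `W` and its Kato element `h₀ c₀`, `h₀` is a unit
  have core : ∀ (L : PowerSeries ℚ_[p]), IsTheMultPAdicLFunctionOf W f p L →
      ∃ w : (IwasawaAlgebra p)ˣ,
        iwasawaToPowerSeries p (trivialZeroFactor W p * c₀ * (w : IwasawaAlgebra p)) =
          PowerSeries.C ((ϖ : ℚ) : ℚ_[p]) * L := by
    intro L hL
    obtain ⟨-, k₀, hk₀, hι₀⟩ :=
      kato_trivialZeroFactor hKato W p hp2 hmult hs₀ hκ hγ hγ' hf D ϖ hϖ L hL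
    rw [hc₀] at hk₀
    obtain ⟨h₀, rfl⟩ := Ideal.mem_span_singleton'.mp hk₀
    obtain ⟨G, hιG, hG⟩ := hE κ γ hκ hγ hγ' f hf D ϖ hϖ L hL
    set t₀ := trivialZeroFactor W p with ht₀
    have hGeq : G = t₀ * (h₀ * c₀) := by
      apply iwasawaToPowerSeries_injective p
      rw [hιG, hι₀]
    have hmem : t₀ * c₀ ∈ Ideal.span {t₀ * (h₀ * c₀)} := by
      rw [← hGeq]
      refine hG (Ideal.mul_mem_mul (Ideal.mem_span_singleton_self _) ?_)
      rw [hc₀]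
      exact Ideal.mem_span_singleton_self _
    have hu₀ : IsUnit h₀ :=
      isUnit_of_mul_mem_span₁ (trivialZeroFactor_ne_zero W p) hc₀0 hmem
    refine ⟨hu₀.unit, ?_⟩
    rw [IsUnit.unit_spec, ← hι₀]
    congr 1
    ring
  obtain ⟨hX, -⟩ := hKato W p hp2 hmult hs₀ hκ hγ hγ' hf D ϖ hϖ
  refine ⟨hX, c₀, hc₀, fun hsplit L hL => ?_, fun hns L hL => ?_⟩
  · obtain ⟨w, hw⟩ := core L ⟨fun _ => hL, fun h => (h hsplit).elim⟩
    refine ⟨w, ?_⟩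
    rw [← hw, trivialZeroFactor_of_split W p hsplit]
  · obtain ⟨w, hw⟩ := core L ⟨fun h => (hns h).elim, fun _ => hL⟩
    refine ⟨w, ?_⟩
    rw [← hw, trivialZeroFactor_of_not_split W p hns, one_mul]

/-- **Conversely, Mazur's main conjecture at `(E, p)` gives the Eisenstein half** (pure algebra, no
hypothesis on `p` or the image): `ch X = (g)` and `ι(T^e · g · w) = ϖ · L` with `w ∈ Λ^×` give
`G = T^e · g · w` with `(T^e) · (g) = (T^e g) ⊆ (T^e g w)`. [folklore] -/
theorem eisensteinHalfAt_of_mazurMainConjectureAt (hMC : X2.MazurMainConjectureAt W p) :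
    EisensteinHalfAt W p := by
  intro κ γ hκ hγ hγ' N _ f hf D ϖ hϖ L hL
  obtain ⟨-, g, hg, hS, hN⟩ := hMC κ γ hκ hγ hγ' f hf D ϖ hϖ
  have h₀ : ∃ w : (IwasawaAlgebra p)ˣ,
      iwasawaToPowerSeries p (trivialZeroFactor W p * g * (w : IwasawaAlgebra p)) =
        PowerSeries.C ((ϖ : ℚ) : ℚ_[p]) * L := by
    by_cases hs : W.HasSplitMultiplicativeReductionAtPrime p
    · obtain ⟨w, hw⟩ := hS hs L (hL.1 hs)
      exact ⟨w, by rw [trivialZeroFactor_of_split W p hs]; exact hw⟩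
    · obtain ⟨w, hw⟩ := hN hs L (hL.2 hs)
      exact ⟨w, by rw [trivialZeroFactor_of_not_split W p hs, one_mul]; exact hw⟩
  obtain ⟨w, hw⟩ := h₀
  refine ⟨trivialZeroFactor W p * g * (w : IwasawaAlgebra p), hw, ?_⟩
  rw [hg, Ideal.span_singleton_mul_span_singleton, Ideal.span_singleton_le_span_singleton]
  refine ⟨((w⁻¹ : (IwasawaAlgebra p)ˣ) : IwasawaAlgebra p), ?_⟩
  rw [mul_assoc (trivialZeroFactor W p * g), Units.mul_inv, mul_one]

/-- **On {`p ≥ 5`, `p ‖ N`, `ρ̄_{E,p}` onto} the Eisenstein half IS Mazur's main conjecture at the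
pair** (granted the PUBLISHED A32): the one-sided typed input of road p1 is neither weaker nor
stronger than the cell's typed input of record there. [cite: Wuthrich2014, Thm. 3 and Cor. 19]
[cite: Skinner2016PacificMC, Thm. A (§1) (shape)] -/
theorem eisensteinHalfAt_iff_mazurMainConjectureAt
    (hKato : kato_charIdeal_dvd_multiplicative_of_surjective)
    (hp : 5 ≤ p) (hmult : W.HasMultiplicativeReductionAtPrime p) (hsurj : Surj W p) :
    EisensteinHalfAt W p ↔ X2.MazurMainConjectureAt W p :=
  ⟨mazurMainConjectureAt_of_eisensteinHalf W p hKato hp hmult hsurj,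
    eisensteinHalfAt_of_mazurMainConjectureAt W p⟩

/-- **At a (ram) pair the Eisenstein half is PRINT**: Skinner 2016 Thm. A (named fact `hA =
thmA_charIdeal_multiplicative`, as printed: `p ≥ 3` multiplicative, (irr), (ram)) gives the whole
main conjecture there, in the uniform shape `skinner_trivialZeroFactor`; `ϖ ≠ 0` because
`Ω⁺_f > 0` (`IsNewform0.plusPeriod_pos_holds`). So the typed input exceeds print exactly on the
`¬ Ram` pairs — on X11a. [cite: Skinner2016PacificMC, Thm. A (§1) and §3.2–3.3] -/
theorem eisensteinHalfAt_of_thmA_of_ram (hA : thmA_charIdeal_multiplicative) (hp : 3 ≤ p)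
    (hmult : W.HasMultiplicativeReductionAtPrime p) (hirr : Irr W p) (hram : Ram W p) :
    EisensteinHalfAt W p := by
  intro κ γ hκ hγ hγ' N _ f hf D ϖ hϖ L hL
  have hϖ0 : ϖ ≠ 0 := by
    intro h
    have hpos : 0 < plusPeriod f := IsNewform0.plusPeriod_pos_holds hf.1 hf.coeffField_eq_bot
    rw [h, Rat.cast_zero, zero_mul] at hϖ
    exact hpos.ne' hϖ.symm
  obtain ⟨g, hg, w, hι⟩ :=
    skinner_trivialZeroFactor hA W p hp hmult hirr hram hκ hγ hγ' hf D ϖ hϖ0 hϖ L hL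
  refine ⟨trivialZeroFactor W p * g * (w : IwasawaAlgebra p), hι, ?_⟩
  rw [hg, Ideal.span_singleton_mul_span_singleton, Ideal.span_singleton_le_span_singleton]
  refine ⟨((w⁻¹ : (IwasawaAlgebra p)ˣ) : IwasawaAlgebra p), ?_⟩
  rw [mul_assoc (trivialZeroFactor W p * g), Units.mul_inv, mul_one]

/-- **`BSD(E,p)` on class X11a at `p ≥ 5` with surjective `ρ̄_{E,p}` from the Eisenstein half** —
the socket of road p1: the typed OPEN input `EisensteinHalfAt W p` (where a (ram)-free Skinner-§3.1
transfer would land) plus the PUBLISHED named facts Kato–Wuthrich A32 (`hKato`), Stein–Wuthrich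
2013 Thm. 6.1 split / non-split (`hJs`, `hJn`), Greenberg–Stevens (`hGS`), Gross–Zagier–Kolyvagin
(`hGZK`) and modularity counted once (`hNf : exists_isNewformOf`). Glue:
`mazurMainConjectureAt_of_eisensteinHalf` + `bsdp_of_mazurMainConjectureAt_heightFree`. Nothing
booked; no label change. [cite: SteinWuthrich2013, Thm. 6.1 (p. 20)] [cite: Wuthrich2014, Thm. 3 and Cor. 19]
[cite: Skinner2016PacificMC, §3.1–3.3 (shape)] -/
theorem bsdp_of_eisensteinHalf (hNf : exists_isNewformOf)
    (hKato : kato_charIdeal_dvd_multiplicative_of_surjective)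
    (hJs : thm61_splitMultiplicative) (hJn : thm61_nonsplitMultiplicative)
    (hGZK : rank_eq_analyticRank_of_analyticRank_le_one)
    (hGS : greenberg_stevens (W := W) (p := p))
    (hX : ClassX11a W p) (hp : 5 ≤ p) (hsurj : Surj W p) (hE : EisensteinHalfAt W p) :
    BSDp W p :=
  bsdp_of_mazurMainConjectureAt_heightFree hJs hJn hGZK (hasEntireLFunction_rat_of_exists_isNewformOf hNf)
    (nonempty_modularParametrizationData_of_exists_isNewformOf hNf
      IsNewformOf.exists_maninConstant_ne_zero_holds) hGS hX
    (mazurMainConjectureAt_of_eisensteinHalf W p hKato hp hX.mult hsurj hE)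

/-- **The surjective leaf from the Eisenstein half at every such pair** (target form).
[cite: SteinWuthrich2013, Thm. 6.1 (p. 20)] [cite: Wuthrich2014, Thm. 3 and Cor. 19] -/
theorem Leaf.bsdp_of_surj_of_eisensteinHalf (hNf : exists_isNewformOf)
    (hKato : kato_charIdeal_dvd_multiplicative_of_surjective)
    (hJs : thm61_splitMultiplicative) (hJn : thm61_nonsplitMultiplicative)
    (hGZK : rank_eq_analyticRank_of_analyticRank_le_one)
    (hGS : greenberg_stevens (W := W) (p := p))
    (hL : Leaf W p) (hsurj : Surj W p) (hE : EisensteinHalfAt W p) : BSDp W p :=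
  bsdp_of_eisensteinHalf W p hNf hKato hJs hJn hGZK hGS hL.classX11a hL.five_le hsurj hE

/-- **Road p1's socket reaches the cell's residual crux of record BY NAME on the surjective
sub-leaf**: item stmt-BirchSwinnertonDyer-19064 `X11aLowerHalf` asks for
`Typed.MissingLowerBoundAt W p` (`ord_p #Ш_an ≤ ord_p #Ш`) at every X11a pair; at an X11a pair with
`p ≥ 5` and `ρ̄_{E,p}` onto, the Eisenstein half delivers it (through `BSD(E,p)`,
`Typed.missingPPartAt_of_bsdp`, `Typed.lower_and_upper_of_missingPPartAt`; `Ш` finite by GZK).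
[cite: Miller2011LMS, Def. 1.1] [cite: SteinWuthrich2013, Thm. 6.1 (p. 20)] -/
theorem missingLowerBoundAt_of_eisensteinHalf (hNf : exists_isNewformOf)
    (hKato : kato_charIdeal_dvd_multiplicative_of_surjective)
    (hJs : thm61_splitMultiplicative) (hJn : thm61_nonsplitMultiplicative)
    (hGZK : rank_eq_analyticRank_of_analyticRank_le_one)
    (hGS : greenberg_stevens (W := W) (p := p))
    (hX : ClassX11a W p) (hp : 5 ≤ p) (hsurj : Surj W p) (hE : EisensteinHalfAt W p) :
    MissingLowerBoundAt W p := by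
  haveI : Finite W.sha := (hGZK W (by rw [hX.analyticRank_eq_zero]; exact zero_le_one)).2
  exact (lower_and_upper_of_missingPPartAt W p
    (missingPPartAt_of_bsdp W p (bsdp_of_eisensteinHalf W p hNf hKato hJs hJn hGZK hGS hX hp hsurj hE))).1

end Main

end Summit.BirchSwinnertonDyer.Rank1Residual.X11a

end
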